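import Summits.QuantumFields.YangMills.Theorems.BalabanLadderNTReferenceTorusTempered
import Summits.QuantumFields.YangMills.Theorems.BalabanLadderNTReferenceTorusExplicit
import HarnessLib

/-!
# Seam `UVSeamRec` (stmt-QuantumFields-20043), conjunct 2 of `stub_floorsEngine` in TEMPERED currency: the two-point
# floor on every torus from ONE torus per coupling, with ceilings only on GOOD exteriors + rarity

Helper file (`--supports stmt-QuantumFields-20043`; owner R78; lead ym-spine-20043-p1 g7 09:44Z located suggestion)
of the fleet lead prover of crux `NT` (unit `ym-spine-19353-p1`, g5); route-independent.  CLAUSE SERVED: conjunct 2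
(the `Q2(θv, v) ≥ ε` floor, compactly supported positive-time witness) of the registered v4-F `stub_floorsEngine`.
The tempered `∀ L` statement on top of `…NTReferenceTorusTempered.lean` (p523924): per coupling `β` the engine names

* the transfer cube `P_β = [−RP(β), RP(β)]⁴`, `RP(β) = ⌈(σ+κ)/aβ⌉₊ + 1` (origin-centred; holds the supports' collar);
* a measurable set `Good β` of exteriors of `P_β` and a rarity `δ(β)`: `μ_{β,L}(lift⁻¹ (Good β)ᶜ) ≤ δ(β)` on EVERY torus
  `2L+1` with `aβ·L ≥ σ+κ+1` (uniform-in-volume large-field rarity — the seam's tempered currency, cf. p518354/p519295);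
* E1/E2-osc for `P_β` ON `Good β` only (`C₁/d⁴`, `C₂/(d⁴(1+‖y−x‖)⁴)`);
* the two-point floor on ONE torus `2L₀(β)+1` with the TEMPERED margin
  `M₂ᵗ(β) = c(β)·(Σ|θv|)(Σ|v|) + C₂(aβ/κ)⁴ ΣΣ|θv||v|/(1+‖y−x‖)⁴`,
  `c(β) = 2((k+2Mδ)² + 4M²δ) + 8M²δ`, `k = C₁(aβ/κ)⁴`, `M ≥ sup|dens|`;

and gets `Q2_{β,L}(θv,v) ≥ ε` on every torus `aβ·L ≥ σ+κ+1`, eventually in `β` (`q2_floor_of_torusReference_tempered`),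
hence conjunct 2 verbatim (`twoPointConjunct_of_torusTempered`).  General `(G, r, a)`; no `SU(2)`-specific step; at
`Good = univ`, `δ = 0` this is g4's `q2_floor_of_torusReference` restricted to the transfer cube.  NOTE (numbers): the
`δ`-terms of `M₂ᵗ` are summed against `≈ aβ⁻⁸‖v‖₁²` pairs, so the engine's rarity must beat `aβ⁸` — exponential
large-field rarity vs a power of the unit: the expected regime.

Refs: lead line fleet INBOX 2026-08-27T09:44:53Z; seam-s2 `CEILINGS-KERNEL-ANALYSIS-seam-s2.md` §2–4 (why tempered);
g4 `…NTReferenceTorusExplicit.lean` (`q2_floor_of_torusReference`, followed here).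
-/

set_option autoImplicit false

noncomputable section

open scoped SchwartzMap
open MeasureTheory Filter Topology
open Literature.MathematicalPhysics.QuantumFieldTheory Literature.MathematicalPhysics.QuantumLattice
open Literature.Probability.LatticeModels
open Summit.QuantumFields.YangMills.Cruxes.OSLegsFromFemtoAndGap.DlrCollarTransfer

namespace Summit.QuantumFields.YangMills.Cruxes.NT.Reference

section Torus

variable (G : Type) [Group G] [TopologicalSpace G] [IsTopologicalGroup G] [CompactSpace G]
  [MeasurableSpace G] [BorelSpace G] (r : LatticeRep G)

/-- **TEMPERED two-point floor on every torus from ONE torus per coupling** (module docstring; explicit witnesses).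
[folklore] -/
theorem q2_floor_of_torusReference_tempered (a : ℝ → ℝ) (ha₀ : ∀ β, 0 < a β) (ha : Tendsto a atTop (𝓝 0))
    {C₁ C₂ σ κ M : ℝ} (hC₁ : 0 ≤ C₁) (hC₂ : 0 ≤ C₂) (hσ : 0 < σ) (hκ : 0 < κ)
    (hM : ∀ (x : Fin 4 → ℤ) (U : LGConfig 4 G), |dens G r x U| ≤ M)
    (RP : ℝ → ℕ) (hRP : ∀ β, RP β = ⌈(σ + κ) / a β⌉₊ + 1)
    (Good : ℝ → Set (LGConfig 4 G)) (hGood : ∀ β, MeasurableSet (Good β)) (δ : ℝ → ℝ)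
    (hE1 : ∃ β₁ : ℝ, ∀ β : ℝ, β₁ ≤ β → ∀ ζ ∈ Good β, ∀ ζ' ∈ Good β, ∀ x : Fin 4 → ℤ,
      1 ≤ depth (fun _ => -(RP β : ℤ)) (2 * RP β + 1) x →
        |kerE G r β (fun _ => -(RP β : ℤ)) (2 * RP β + 1) ζ (dens G r x) -
          kerE G r β (fun _ => -(RP β : ℤ)) (2 * RP β + 1) ζ' (dens G r x)| ≤
          C₁ / (depth (fun _ => -(RP β : ℤ)) (2 * RP β + 1) x : ℝ) ^ 4)
    (hE2 : ∃ β₂ : ℝ, ∀ β : ℝ, β₂ ≤ β → ∀ ζ ∈ Good β, ∀ ζ' ∈ Good β, ∀ x y : Fin 4 → ℤ,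
      1 ≤ depth (fun _ => -(RP β : ℤ)) (2 * RP β + 1) x → 1 ≤ depth (fun _ => -(RP β : ℤ)) (2 * RP β + 1) y →
        |kerCov G r β (fun _ => -(RP β : ℤ)) (2 * RP β + 1) ζ (dens G r x) (dens G r y) -
          kerCov G r β (fun _ => -(RP β : ℤ)) (2 * RP β + 1) ζ' (dens G r x) (dens G r y)| ≤
          C₂ / ((min (depth (fun _ => -(RP β : ℤ)) (2 * RP β + 1) x)
            (depth (fun _ => -(RP β : ℤ)) (2 * RP β + 1) y) : ℕ) : ℝ) ^ 4 / (1 + ‖siteToE (y - x)‖) ^ 4)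
    (hrare : ∃ βr : ℝ, ∀ β : ℝ, βr ≤ β → ∀ L : ℕ, σ + κ + 1 ≤ a β * L →
      (wilsonMeasure (d := 4) (L := 2 * L + 1) r.ρ β).real ((torusLift (2 * L + 1)) ⁻¹' Good β)ᶜ ≤ δ β)
    (v : 𝓢(EuclideanSpace ℝ (Fin 4), ℝ)) (ε β₅ : ℝ) (L₀ : ℝ → ℕ)
    (hvσ : tsupport (v : EuclideanSpace ℝ (Fin 4) → ℝ) ⊆ Metric.closedBall 0 σ)
    (HR : ∀ β : ℝ, β₅ ≤ β → σ + κ + 1 ≤ a β * L₀ β ∧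
        ε + (2 * ((C₁ * (a β / κ) ^ 4 + 2 * M * δ β) * (C₁ * (a β / κ) ^ 4 + 2 * M * δ β) + 4 * M * M * δ β) +
              2 * (2 * M * M) * (δ β + δ β)) *
            ((∑ x ∈ box 4 (L₀ β), |thetaTest 4 v (a β • siteToE x)|) * ∑ y ∈ box 4 (L₀ β), |v (a β • siteToE y)|) +
          C₂ * (a β / κ) ^ 4 * ∑ x ∈ box 4 (L₀ β), ∑ y ∈ box 4 (L₀ β),
            |thetaTest 4 v (a β • siteToE x)| * |v (a β • siteToE y)| / (1 + ‖siteToE (y - x)‖) ^ 4 ≤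
          Q2 G r β (L₀ β) (a β) (thetaTest 4 v) v) :
    ∃ β₅' : ℝ, ∀ β : ℝ, β₅' ≤ β → ∀ L : ℕ, σ + κ + 1 ≤ a β * L → ε ≤ Q2 G r β L (a β) (thetaTest 4 v) v := by
  obtain ⟨β₁, H1⟩ := hE1
  obtain ⟨β₂, H2⟩ := hE2
  obtain ⟨βr, Hr⟩ := hrare
  have hℓ : 2 * (σ + κ) < 2 * (σ + κ) + 5 := by linarith
  have hδ' : 0 < min (1 / 4 : ℝ) (((2 * (σ + κ) + 5) - 2 * (σ + κ)) / 5) := lt_min (by norm_num) (by linarith)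
  obtain ⟨βa, Ha⟩ := eventually_le_of_tendsto ha hδ'
  refine ⟨max (max β₅ βa) (max (max β₁ β₂) βr), fun β hβ L hL => ?_⟩
  have hβ₅ : β₅ ≤ β := le_trans (le_max_left _ _) (le_trans (le_max_left _ _) hβ)
  have hβa : βa ≤ β := le_trans (le_max_right _ _) (le_trans (le_max_left _ _) hβ)
  have hβ₁ : β₁ ≤ β := le_trans (le_max_left _ _) (le_trans (le_max_left _ _) (le_trans (le_max_right _ _) hβ))
  have hβ₂ : β₂ ≤ β := le_trans (le_max_right _ _) (le_trans (le_max_left _ _) (le_trans (le_max_right _ _) hβ))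
  have hβr : βr ≤ β := le_trans (le_max_right _ _) (le_trans (le_max_right _ _) hβ)
  have hα : 0 < a β := ha₀ β
  have hsmall := Ha β hβa
  have h4 : a β ≤ 1 / 4 := hsmall.trans (min_le_left _ _)
  have hℓ' : a β ≤ ((2 * (σ + κ) + 5) - 2 * (σ + κ)) / 5 := hsmall.trans (min_le_right _ _)
  have hρ' : a β ≤ ((σ + κ + 2 * a β) - σ - κ) / 2 := by linarith
  obtain ⟨hL₀, HRβ⟩ := HR β hβ₅
  obtain ⟨-, -, hLL, hNL, -, hdep⟩ := scales hα hσ hκ h4 hρ' hℓ' hL (RP := ⌈(σ + κ) / a β⌉₊ + 1) rfl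
  obtain ⟨-, -, hLL₀, hNL₀, -, -⟩ := scales hα hσ hκ h4 hρ' hℓ' hL₀ (RP := ⌈(σ + κ) / a β⌉₊ + 1) rfl
  rw [← hRP β] at hLL hLL₀ hdep
  set N := ⌈σ / a β⌉₊ with hN
  have hθ0 : ∀ x, x ∉ box 4 N → thetaTest 4 v (a β • siteToE x) = 0 := fun x hx =>
    thetaTest_smul_siteToE_eq_zero hα hvσ hx
  have hw0 : ∀ y, y ∉ box 4 N → v (a β • siteToE y) = 0 := fun y hy =>
    apply_smul_siteToE_eq_zero hα hvσ hy
  -- per-pair tempered torus-to-torus transfer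
  have hpair : ∀ x ∈ box 4 N, ∀ y ∈ box 4 N,
      |(torusE G r β L (fun U => dens G r x U * dens G r y U) - torusE G r β L (dens G r x) * torusE G r β L (dens G r y))
        - (torusE G r β (L₀ β) (fun U => dens G r x U * dens G r y U) -
            torusE G r β (L₀ β) (dens G r x) * torusE G r β (L₀ β) (dens G r y))| ≤
      (2 * ((C₁ * (a β / κ) ^ 4 + 2 * M * δ β) * (C₁ * (a β / κ) ^ 4 + 2 * M * δ β) + 4 * M * M * δ β) +
          2 * (2 * M * M) * (δ β + δ β)) +
        C₂ * (a β / κ) ^ 4 / (1 + ‖siteToE (y - x)‖) ^ 4 := by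
    intro x hx y hy
    have h := pair_transfer_torus_tempered G r β hC₁ hC₂ hκ hα hM hLL hLL₀ (hGood β) (Hr β hβr L hL)
      (Hr β hβr (L₀ β) hL₀) (H1 β hβ₁) (H2 β hβ₂) (hdep x hx) (hdep y hy)
    linarith
  -- the sums restricted to the support box
  have eQ : ∀ K : ℕ, N ≤ K → Q2 G r β K (a β) (thetaTest 4 v) v = ∑ x ∈ box 4 N, ∑ y ∈ box 4 N,
      thetaTest 4 v (a β • siteToE x) * v (a β • siteToE y) *
        (torusE G r β K (fun U => dens G r x U * dens G r y U) -
          torusE G r β K (dens G r x) * torusE G r β K (dens G r y)) := fun K hK => by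
    unfold Q2
    exact sum_box₂_eq hK _ (fun x hx y => by rw [hθ0 x hx]; ring) (fun y hy x => by rw [hw0 y hy]; ring)
  have e1 : ∑ x ∈ box 4 (L₀ β), |thetaTest 4 v (a β • siteToE x)| =
      ∑ x ∈ box 4 N, |thetaTest 4 v (a β • siteToE x)| :=
    sum_box_eq_sum_box hNL₀ _ fun x hx => by rw [hθ0 x hx, abs_zero]
  have e2 : ∑ y ∈ box 4 (L₀ β), |v (a β • siteToE y)| = ∑ y ∈ box 4 N, |v (a β • siteToE y)| :=
    sum_box_eq_sum_box hNL₀ _ fun y hy => by rw [hw0 y hy, abs_zero]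
  have e3 : ∑ x ∈ box 4 (L₀ β), ∑ y ∈ box 4 (L₀ β),
      |thetaTest 4 v (a β • siteToE x)| * |v (a β • siteToE y)| / (1 + ‖siteToE (y - x)‖) ^ 4 =
      ∑ x ∈ box 4 N, ∑ y ∈ box 4 N,
      |thetaTest 4 v (a β • siteToE x)| * |v (a β • siteToE y)| / (1 + ‖siteToE (y - x)‖) ^ 4 :=
    sum_box₂_eq hNL₀ _ (fun x hx y => by rw [hθ0 x hx, abs_zero, zero_mul, zero_div])
      (fun y hy x => by rw [hw0 y hy, abs_zero, mul_zero, zero_div])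
  have hsum := sum_sum_sub_le_of_abs_sub_le (box 4 N) (fun x => thetaTest 4 v (a β • siteToE x))
    (fun y => v (a β • siteToE y))
    (fun x y => torusE G r β L (fun U => dens G r x U * dens G r y U) -
      torusE G r β L (dens G r x) * torusE G r β L (dens G r y))
    (fun x y => torusE G r β (L₀ β) (fun U => dens G r x U * dens G r y U) -
      torusE G r β (L₀ β) (dens G r x) * torusE G r β (L₀ β) (dens G r y))
    (fun x y => C₂ * (a β / κ) ^ 4 / (1 + ‖siteToE (y - x)‖) ^ 4)
    (2 * ((C₁ * (a β / κ) ^ 4 + 2 * M * δ β) * (C₁ * (a β / κ) ^ 4 + 2 * M * δ β) + 4 * M * M * δ β) +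
      2 * (2 * M * M) * (δ β + δ β)) hpair
  have e4 : ∑ x ∈ box 4 N, ∑ y ∈ box 4 N, |thetaTest 4 v (a β • siteToE x)| * |v (a β • siteToE y)| *
      (C₂ * (a β / κ) ^ 4 / (1 + ‖siteToE (y - x)‖) ^ 4) =
      C₂ * (a β / κ) ^ 4 * ∑ x ∈ box 4 N, ∑ y ∈ box 4 N,
        |thetaTest 4 v (a β • siteToE x)| * |v (a β • siteToE y)| / (1 + ‖siteToE (y - x)‖) ^ 4 := by
    rw [Finset.mul_sum]
    refine Finset.sum_congr rfl fun x _ => ?_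
    rw [Finset.mul_sum]
    refine Finset.sum_congr rfl fun y _ => ?_
    ring
  rw [eQ (L₀ β) hNL₀, e1, e2, e3] at HRβ
  rw [e4] at hsum
  rw [eQ L hNL]
  linarith [hsum, HRβ]

/-- **Conjunct 2 of `stub_floorsEngine` in TEMPERED currency** (module docstring): the same hypotheses packaged with a
positive-time witness `v` in the ball of radius `σ` ⇒ a compactly supported positive-time `v`, `ε > 0`, and the floor
`Q2(θv, v) ≥ ε` on every large torus at every large coupling. [folklore] -/
theorem twoPointConjunct_of_torusTempered (a : ℝ → ℝ) (ha₀ : ∀ β, 0 < a β) (ha : Tendsto a atTop (𝓝 0))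
    {C₁ C₂ σ κ M : ℝ} (hC₁ : 0 ≤ C₁) (hC₂ : 0 ≤ C₂) (hσ : 0 < σ) (hκ : 0 < κ)
    (hM : ∀ (x : Fin 4 → ℤ) (U : LGConfig 4 G), |dens G r x U| ≤ M)
    (RP : ℝ → ℕ) (hRP : ∀ β, RP β = ⌈(σ + κ) / a β⌉₊ + 1)
    (Good : ℝ → Set (LGConfig 4 G)) (hGood : ∀ β, MeasurableSet (Good β)) (δ : ℝ → ℝ)
    (hE1 : ∃ β₁ : ℝ, ∀ β : ℝ, β₁ ≤ β → ∀ ζ ∈ Good β, ∀ ζ' ∈ Good β, ∀ x : Fin 4 → ℤ,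
      1 ≤ depth (fun _ => -(RP β : ℤ)) (2 * RP β + 1) x →
        |kerE G r β (fun _ => -(RP β : ℤ)) (2 * RP β + 1) ζ (dens G r x) -
          kerE G r β (fun _ => -(RP β : ℤ)) (2 * RP β + 1) ζ' (dens G r x)| ≤
          C₁ / (depth (fun _ => -(RP β : ℤ)) (2 * RP β + 1) x : ℝ) ^ 4)
    (hE2 : ∃ β₂ : ℝ, ∀ β : ℝ, β₂ ≤ β → ∀ ζ ∈ Good β, ∀ ζ' ∈ Good β, ∀ x y : Fin 4 → ℤ,
      1 ≤ depth (fun _ => -(RP β : ℤ)) (2 * RP β + 1) x → 1 ≤ depth (fun _ => -(RP β : ℤ)) (2 * RP β + 1) y →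
        |kerCov G r β (fun _ => -(RP β : ℤ)) (2 * RP β + 1) ζ (dens G r x) (dens G r y) -
          kerCov G r β (fun _ => -(RP β : ℤ)) (2 * RP β + 1) ζ' (dens G r x) (dens G r y)| ≤
          C₂ / ((min (depth (fun _ => -(RP β : ℤ)) (2 * RP β + 1) x)
            (depth (fun _ => -(RP β : ℤ)) (2 * RP β + 1) y) : ℕ) : ℝ) ^ 4 / (1 + ‖siteToE (y - x)‖) ^ 4)
    (hrare : ∃ βr : ℝ, ∀ β : ℝ, βr ≤ β → ∀ L : ℕ, σ + κ + 1 ≤ a β * L →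
      (wilsonMeasure (d := 4) (L := 2 * L + 1) r.ρ β).real ((torusLift (2 * L + 1)) ⁻¹' Good β)ᶜ ≤ δ β)
    (hR2 : ∃ (v : 𝓢(EuclideanSpace ℝ (Fin 4), ℝ)) (ε β₅ : ℝ) (L₀ : ℝ → ℕ),
      tsupport (v : EuclideanSpace ℝ (Fin 4) → ℝ) ⊆ {y | 0 < y 0} ∧
      tsupport (v : EuclideanSpace ℝ (Fin 4) → ℝ) ⊆ Metric.closedBall 0 σ ∧ 0 < ε ∧
      ∀ β : ℝ, β₅ ≤ β → σ + κ + 1 ≤ a β * L₀ β ∧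
        ε + (2 * ((C₁ * (a β / κ) ^ 4 + 2 * M * δ β) * (C₁ * (a β / κ) ^ 4 + 2 * M * δ β) + 4 * M * M * δ β) +
              2 * (2 * M * M) * (δ β + δ β)) *
            ((∑ x ∈ box 4 (L₀ β), |thetaTest 4 v (a β • siteToE x)|) * ∑ y ∈ box 4 (L₀ β), |v (a β • siteToE y)|) +
          C₂ * (a β / κ) ^ 4 * ∑ x ∈ box 4 (L₀ β), ∑ y ∈ box 4 (L₀ β),
            |thetaTest 4 v (a β • siteToE x)| * |v (a β • siteToE y)| / (1 + ‖siteToE (y - x)‖) ^ 4 ≤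
          Q2 G r β (L₀ β) (a β) (thetaTest 4 v) v) :
    ∃ (v : 𝓢(EuclideanSpace ℝ (Fin 4), ℝ)) (ε β₅ Λ₅ : ℝ),
      HasCompactSupport (v : EuclideanSpace ℝ (Fin 4) → ℝ) ∧
      tsupport (v : EuclideanSpace ℝ (Fin 4) → ℝ) ⊆ {y : EuclideanSpace ℝ (Fin 4) | 0 < y 0} ∧ 0 < ε ∧
      ∀ β : ℝ, β₅ ≤ β → ∀ L : ℕ, Λ₅ ≤ a β * L → ε ≤ Q2 G r β L (a β) (thetaTest 4 v) v := by
  obtain ⟨v, ε, β₅, L₀, hvpos, hvσ, hε, HR⟩ := hR2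
  obtain ⟨β₆, H⟩ := q2_floor_of_torusReference_tempered G r a ha₀ ha hC₁ hC₂ hσ hκ hM RP hRP Good hGood δ hE1 hE2 hrare
    v ε β₅ L₀ hvσ HR
  exact ⟨v, ε, β₆, σ + κ + 1,
    (isCompact_closedBall (0 : EuclideanSpace ℝ (Fin 4)) σ).of_isClosed_subset (isClosed_tsupport _) hvσ, hvpos, hε, H⟩

end Torus

end Summit.QuantumFields.YangMills.Cruxes.NT.Reference

end
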